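import Literature.NumberTheory.Transcendental.GammaIsoTwistedSteps
import Literature.NumberTheory.Transcendental.GammaGeometricStep
import HarnessLib

/-!
# Twisted Γ-isomorphisms: the geometric step of Bays–Kirby Prop. 11.2 over a base isomorphism

Companion of `GammaIsoTwisted*.lean`: the twisted (two-base, over an isomorphism `σ` of base
Γ-fields) form of `GammaLocusRegular.lean`, `GammaLocusOverK.lean` and `GammaGeometricStep.lean`
(M. Bays, J. Kirby, *Pseudo-exponential maps, variants, and quasiminimality*, Algebra & Number
Theory 12 (2018), Def. 11.1, Prop. 11.2 / Thm 11.6 (proof) along the lines of Lemma 8.3), needed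
for Kirby 2010, Thm 2.1 = `IsZilberField.eclIso_extension`:

* `GammaField.locusIdealTw` — the locus ideal of `(b, exp b)` over `⟨K₁ c⟩` transported along the
  field isomorphism `θ : ⟨K₁ c⟩ ≅ ⟨K₂ c'⟩` of a twisted Γ-isomorphism; `mem_locusIdealTw_iff`,
  `isPrime_map_locusIdealTw` (absolute primality from relative algebraic closedness);
* `GammaField.subfieldEquiv` — `σ` on the underlying subfields `K₁⁰ ≃ K₂⁰`;
* `GammaField.mem_vanishingIdeal_image_prodPt_iff_tw` — the ideal over `K₂⁰` of `{α'} × V'` is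
  the `σ`-transport of the ideal over `K₁⁰` of the honest source point;
  `GammaField.isStronglyRotund_locOver_tw` — strong rotundity of `W = Loc(α', V'/K₂)` from
  Γ-closedness of `K₁` (transporting the rotundity data along `σ`,
  `LocusComponents.algebraicIndependent_matrixAct_genericPt_mapCoeff`);
  `GammaField.exists_forall_isDefinedOver_adjoinPt_tw`;
* `GammaField.exists_generic_partner_of_gsgc_tw`, `GammaField.exists_isGammaIsoTw_append_of_gsgc`
  — the generic partner from generic strong Γ-closedness over `K₂` and the isomorphism step.

The proofs are those of the untwisted files; the target-side inputs (GSΓC over `K₂`, genericity,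
Kummer levels) and the source-side inputs (rotundity data over the Γ-closed `K₁`, regularity)
are used as they stand. Everything here is proved.

## References

* M. Bays, J. Kirby, *Pseudo-exponential maps, variants, and quasiminimality*, Algebra & Number
  Theory 12 (2018) 493–549: Def. 3.19, Prop. 3.22, Lemma 4.8, Def. 4.9, Prop. 7.3, Cor. 7.4,
  Lemma 8.3 (proof), Def. 11.1, Prop. 11.2, Thm 11.6 (proof).
* J. Kirby, *On quasiminimal excellent classes*, J. Symbolic Logic 75 (2010): Thm 2.1.
-/

noncomputable section

open Set MvPolynomial

universe u

namespace Literature.NumberTheory.Transcendental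

namespace GammaField

open Literature.ModelTheory.ExponentialFields.ExponentialRing ZilberSaturationMain
  Literature.FieldTheory.Regular Literature.FieldTheory.Kummer

attribute [local instance] MvPolynomial.algebraMvPolynomial

variable {F : Type u} [Field F] [CharZero F] [Literature.ModelTheory.ExponentialFields.ExponentialRing F]
variable {K₁ K₂ : Submodule ℚ F} {σ : fieldOf K₁ ≃+* fieldOf K₂} {N n : ℕ}

/-! ### The transported locus ideal -/

/-- The locus ideal transported to the `c'` side along the field isomorphism
`θ : ⟨K₁ c⟩ ≅ ⟨K₂ c'⟩` of a twisted Γ-isomorphism: `P' = θ(I((a, exp a)/⟨K₁ c⟩)) ⊆ ⟨K₂ c'⟩[X, Y]`.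
[cite: BaysKirby2018ANT, Def. 3.19 (`loc(b'/A) = loc(b/A)`)] -/
abbrev locusIdealTw {c c' : Fin N → F} (hiso : IsGammaIsoTw σ c c') {k : ℕ} (a : Fin k → F) :
    Ideal (MvPolynomial (Fin k ⊕ Fin k) (bfld K₂ c')) :=
  LocusComponents.idealMapCoeff hiso.fieldEquiv (locusIdeal K₁ c a)

/-- `P'` is prime. [folklore] -/
theorem locusIdealTw_isPrime {c c' : Fin N → F} (hiso : IsGammaIsoTw σ c c') {k : ℕ} (a : Fin k → F) :
    (locusIdealTw hiso a).IsPrime :=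
  LocusComponents.idealMapCoeff_isPrime _ _

/-- Membership in `P' = θ(P)`: `f' ∈ P'` iff `θ⁻¹ f'` vanishes at `(b, exp b)`. [folklore] -/
theorem mem_locusIdealTw_iff {c c' : Fin N → F} (hiso : IsGammaIsoTw σ c c') (b : Fin n → F)
    (f' : MvPolynomial (Fin n ⊕ Fin n) (bfld K₂ c')) :
    f' ∈ locusIdealTw hiso b ↔
      aeval (gammaPt b) (MvPolynomial.map (hiso.fieldEquiv.symm : bfld K₂ c' →+* bfld K₁ c) f') = 0 := by
  rw [locusIdealTw, LocusComponents.idealMapCoeff, Ideal.mem_map_of_equiv]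
  constructor
  · rintro ⟨f, hf, rfl⟩
    have : MvPolynomial.map (hiso.fieldEquiv.symm : bfld K₂ c' →+* bfld K₁ c)
        (MvPolynomial.mapEquiv (Fin n ⊕ Fin n) hiso.fieldEquiv f) = f := by
      change MvPolynomial.map _ (MvPolynomial.map (hiso.fieldEquiv : bfld K₁ c →+* bfld K₂ c') f) = f
      rw [MvPolynomial.map_map, RingEquiv.symm_comp, MvPolynomial.map_id]
    rw [this]
    exact (isGenericPt_locusIdeal K₁ c b f).2 hf
  · intro hf
    refine ⟨MvPolynomial.map (hiso.fieldEquiv.symm : bfld K₂ c' →+* bfld K₁ c) f',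
      (isGenericPt_locusIdeal K₁ c b _).1 hf, ?_⟩
    change MvPolynomial.map (hiso.fieldEquiv : bfld K₁ c →+* bfld K₂ c') (MvPolynomial.map _ f') = f'
    rw [MvPolynomial.map_map, RingEquiv.comp_symm, MvPolynomial.map_id]

/-- **`P'·F[X, Y]` is prime** when `⟨K₁ c⟩` is relatively algebraically closed in
`⟨K₁ c⟩(b, exp b)` (twisted form of `isPrime_map_locusIdeal'`).
[cite: BaysKirby2018ANT, Cor. 7.4, Lemma 8.3 (proof)] -/
theorem isPrime_map_locusIdealTw {c c' : Fin N → F} (hiso : IsGammaIsoTw σ c c') (b : Fin n → F)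
    (hrac : ∀ z ∈ IntermediateField.adjoin (fieldOf K₁) (allGens c ∪ range (gammaPt b)),
      IsAlgebraic (bfld K₁ c) z → z ∈ bfld K₁ c) :
    ((locusIdealTw hiso b).map (MvPolynomial.map (algebraMap (bfld K₂ c') F))).IsPrime := by
  classical
  let Kr := IntermediateField.adjoin (bfld K₁ c) (range (gammaPt b))
  let φ : bfld K₂ c' →+* Kr := (algebraMap (bfld K₁ c) Kr).comp (hiso.fieldEquiv.symm : bfld K₂ c' →+* bfld K₁ c)
  letI algKr : Algebra (bfld K₂ c') Kr := φ.toAlgebra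
  have halg : (algebraMap (bfld K₂ c') Kr) = φ := rfl
  let β : Fin n ⊕ Fin n → Kr := fun j => ⟨gammaPt b j, IntermediateField.subset_adjoin _ _ ⟨j, rfl⟩⟩
  have hmemKr : ∀ z : F, z ∈ Kr ↔ z ∈ IntermediateField.adjoin (fieldOf K₁) (allGens c ∪ range (gammaPt b)) := by
    intro z
    rw [← IntermediateField.mem_restrictScalars (fieldOf K₁), IntermediateField.adjoin_adjoin_left]
  have hcompφ : (algebraMap Kr F).comp φ =
      (algebraMap (bfld K₁ c) F).comp (hiso.fieldEquiv.symm : bfld K₂ c' →+* bfld K₁ c) := by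
    refine RingHom.ext fun w => ?_
    simp only [φ, RingHom.coe_comp, Function.comp_apply]
    rw [IntermediateField.algebraMap_apply, IntermediateField.coe_algebraMap_apply]
  have hrac' : ∀ z : Kr, IsAlgebraic (bfld K₂ c') z → z ∈ range (algebraMap (bfld K₂ c') Kr) := by
    intro z hz
    obtain ⟨p', hp'0, hp'⟩ := hz
    have halgc : IsAlgebraic (bfld K₁ c) (z : F) := by
      refine ⟨p'.map (hiso.fieldEquiv.symm : bfld K₂ c' →+* bfld K₁ c), ?_, ?_⟩
      · exact (Polynomial.map_ne_zero_iff (hiso.fieldEquiv.symm).injective).2 hp'0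
      · have h1 : (algebraMap Kr F) (Polynomial.aeval z p') = 0 := by rw [hp', map_zero]
        rw [Polynomial.aeval_def, Polynomial.hom_eval₂, halg, hcompφ] at h1
        rw [Polynomial.aeval_def, Polynomial.eval₂_map]
        exact h1
    have hzc : (z : F) ∈ bfld K₁ c := hrac _ ((hmemKr z).1 z.2) halgc
    refine ⟨hiso.fieldEquiv ⟨z, hzc⟩, Subtype.ext ?_⟩
    rw [halg]
    simp only [φ, RingHom.coe_comp, Function.comp_apply]
    rw [show (hiso.fieldEquiv.symm : bfld K₂ c' →+* bfld K₁ c) (hiso.fieldEquiv ⟨z, hzc⟩) = ⟨z, hzc⟩ from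
      hiso.fieldEquiv.symm_apply_apply _, IntermediateField.coe_algebraMap_apply,
      IntermediateField.algebraMap_apply]
  have hP : RingHom.ker (aeval β : MvPolynomial (Fin n ⊕ Fin n) (bfld K₂ c') →ₐ[bfld K₂ c'] Kr) =
      locusIdealTw hiso b := by
    ext f'
    rw [RingHom.mem_ker, mem_locusIdealTw_iff]
    have h1 : (algebraMap Kr F) (aeval β f') =
        aeval (gammaPt b) (MvPolynomial.map (hiso.fieldEquiv.symm : bfld K₂ c' →+* bfld K₁ c) f') := by
      rw [aeval_def, eval₂_comp_left, halg, hcompφ, aeval_def, eval₂_map]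
      congr 1
    constructor
    · intro h0
      rw [← h1, show aeval β f' = 0 from h0, map_zero]
    · intro h0
      rw [← h1] at h0
      exact (injective_iff_map_eq_zero (algebraMap Kr F)).1 (algebraMap Kr F).injective _ h0
  rw [← hP]
  exact isPrime_map_ker_aeval (algebraMap (bfld K₂ c') F) β hrac'

/-! ### `σ` on the underlying subfields -/

/-- `σ` as an isomorphism of the underlying subfields `K₁⁰ ≃ K₂⁰` (the coefficient fields of the
`K`-loci, `GammaField.kLocus`). [folklore] -/
def subfieldEquiv (σ : fieldOf K₁ ≃+* fieldOf K₂) : (fieldOf K₁).toSubfield ≃+* (fieldOf K₂).toSubfield where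
  toFun x := ⟨σ ⟨x, x.2⟩, (σ ⟨x, x.2⟩).2⟩
  invFun y := ⟨σ.symm ⟨y, y.2⟩, (σ.symm ⟨y, y.2⟩).2⟩
  left_inv x := Subtype.ext (by
    show ((σ.symm ⟨(σ ⟨x, x.2⟩ : F), (σ ⟨x, x.2⟩).2⟩ : fieldOf K₁) : F) = x
    rw [show (⟨(σ ⟨x, x.2⟩ : F), (σ ⟨x, x.2⟩).2⟩ : fieldOf K₂) = σ ⟨x, x.2⟩ from rfl,
      RingEquiv.symm_apply_apply])
  right_inv y := Subtype.ext (by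
    show ((σ ⟨(σ.symm ⟨y, y.2⟩ : F), (σ.symm ⟨y, y.2⟩).2⟩ : fieldOf K₂) : F) = y
    rw [show (⟨(σ.symm ⟨y, y.2⟩ : F), (σ.symm ⟨y, y.2⟩).2⟩ : fieldOf K₁) = σ.symm ⟨y, y.2⟩ from rfl,
      RingEquiv.apply_symm_apply])
  map_mul' x y := Subtype.ext (by
    show ((σ ⟨x * y, _⟩ : fieldOf K₂) : F) = (σ ⟨x, x.2⟩ : F) * (σ ⟨y, y.2⟩ : F)
    rw [show (⟨(x : F) * y, (x * y).2⟩ : fieldOf K₁) = ⟨x, x.2⟩ * ⟨y, y.2⟩ from rfl, map_mul]; rfl)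
  map_add' x y := Subtype.ext (by
    show ((σ ⟨x + y, _⟩ : fieldOf K₂) : F) = (σ ⟨x, x.2⟩ : F) + (σ ⟨y, y.2⟩ : F)
    rw [show (⟨(x : F) + y, (x + y).2⟩ : fieldOf K₁) = ⟨x, x.2⟩ + ⟨y, y.2⟩ from rfl, map_add]; rfl)

/-- `subfieldEquiv σ` is `σ` on underlying elements. [folklore] -/
@[simp] theorem coe_subfieldEquiv (σ : fieldOf K₁ ≃+* fieldOf K₂) (x : (fieldOf K₁).toSubfield) :
    ((subfieldEquiv σ x : (fieldOf K₂).toSubfield) : F) = (σ ⟨x, x.2⟩ : F) := rfl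

/-! ### `θ(c/M!) = c'/M!` -/

/-- `θ(c/M!) = c'/M!` and `θ(exp (c/M!)) = exp (c'/M!)` for a twisted Γ-isomorphism. [folklore] -/
theorem IsGammaIsoTw.coe_fieldEquiv_div_factorial {c c' : Fin N → F} (hiso : IsGammaIsoTw σ c c') (M : ℕ)
    (i : Fin N) :
    (hiso.fieldEquiv ⟨c i / (M.factorial : F), (div_factorial_mem_bfld c M i).1⟩ : F) =
        c' i / (M.factorial : F) ∧
      (hiso.fieldEquiv ⟨exp (c i / (M.factorial : F)), (div_factorial_mem_bfld c M i).2⟩ : F) =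
        exp (c' i / (M.factorial : F)) := by
  constructor
  · rw [hiso.coe_fieldEquiv_eq_transport (div_factorial_mem_sup_span K₁ c M i), div_natCast_eq_smul,
      hiso.transport_smul _ (Submodule.mem_sup_right (Submodule.subset_span ⟨i, rfl⟩)),
      hiso.transport_apply, div_natCast_eq_smul]
  · exact hiso.coe_fieldEquiv_exp_div M i _

/-! ### The ideal over `K₂⁰` of `{α'} × V'` is the `σ`-transport of the ideal of the source point -/

/-- **The ideal over `K₂⁰` of `{(a', exp a')} × (Z(P')_F ∩ Gⁿ)`, `a' = c'/M!`, is the transport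
along `σ` of the ideal over `K₁⁰` of the point `(c/M!, b, exp (c/M!), exp b)`** (twisted form of
`mem_vanishingIdeal_image_prodPt_iff`: now `θ` is `σ` on `K₁⁰`, so substituting `α'` and pulling
back along `θ` replaces coefficients by their `σ⁻¹`-images).
[cite: BaysKirby2018ANT, Def. 11.1, Thm 11.6 (proof)] -/
theorem mem_vanishingIdeal_image_prodPt_iff_tw [IsAlgClosed F] {c c' : Fin N → F}
    (hiso : IsGammaIsoTw σ c c') (b : Fin n → F) (M : ℕ)
    [hprime : ((locusIdealTw hiso b).map (algebraMap (MvPolynomial (Fin n ⊕ Fin n) (bfld K₂ c'))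
      (MvPolynomial (Fin n ⊕ Fin n) F))).IsPrime]
    (hne : (zeroLocus F ((locusIdealTw hiso b).map (algebraMap (MvPolynomial (Fin n ⊕ Fin n) (bfld K₂ c'))
      (MvPolynomial (Fin n ⊕ Fin n) F))) ∩ torusLocus F n).Nonempty)
    (p : MvPolynomial (Fin (N + n) ⊕ Fin (N + n)) (fieldOf K₂).toSubfield) :
    p ∈ MvPolynomial.vanishingIdeal (fieldOf K₂).toSubfield
        (prodPt (gammaPt fun i => c' i / (M.factorial : F)) ''
          (zeroLocus F ((locusIdealTw hiso b).map (algebraMap (MvPolynomial (Fin n ⊕ Fin n) (bfld K₂ c'))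
            (MvPolynomial (Fin n ⊕ Fin n) F))) ∩ torusLocus F n)) ↔
      aeval (gammaPt (Fin.append (fun i => c i / (M.factorial : F)) b))
        (MvPolynomial.map ((subfieldEquiv σ).symm : (fieldOf K₂).toSubfield →+* (fieldOf K₁).toSubfield) p) = 0 := by
  classical
  set p₁ := MvPolynomial.map ((subfieldEquiv σ).symm : (fieldOf K₂).toSubfield →+* (fieldOf K₁).toSubfield) p
    with hp₁
  have hpp₁ : p = MvPolynomial.map ((subfieldEquiv σ) : (fieldOf K₁).toSubfield →+* (fieldOf K₂).toSubfield) p₁ := by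
    rw [hp₁, map_map_symm]
  let ι₀ : (fieldOf K₁).toSubfield →+* bfld K₁ c :=
    { toFun := fun x => ⟨x, (bfld K₁ c).algebraMap_mem ⟨x, x.2⟩⟩
      map_one' := Subtype.ext rfl
      map_mul' := fun _ _ => Subtype.ext rfl
      map_zero' := Subtype.ext rfl
      map_add' := fun _ _ => Subtype.ext rfl }
  let ι₀' : (fieldOf K₂).toSubfield →+* bfld K₂ c' :=
    { toFun := fun x => ⟨x, (bfld K₂ c').algebraMap_mem ⟨x, x.2⟩⟩
      map_one' := Subtype.ext rfl
      map_mul' := fun _ _ => Subtype.ext rfl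
      map_zero' := Subtype.ext rfl
      map_add' := fun _ _ => Subtype.ext rfl }
  have hι₀ : ∀ x, ((ι₀ x : bfld K₁ c) : F) = x := fun _ => rfl
  have hι₀' : ∀ x, ((ι₀' x : bfld K₂ c') : F) = x := fun _ => rfl
  have hθι : ∀ x, hiso.fieldEquiv (ι₀ x) = ι₀' (subfieldEquiv σ x) := fun x =>
    Subtype.ext (by rw [hι₀', coe_subfieldEquiv]; exact hiso.coe_fieldEquiv_algebraMap ⟨x, x.2⟩)
  let w : Fin (N + n) ⊕ Fin (N + n) → MvPolynomial (Fin n ⊕ Fin n) (bfld K₁ c) :=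
    Sum.elim (Fin.addCases (fun i => C ⟨c i / (M.factorial : F), (div_factorial_mem_bfld c M i).1⟩)
        fun j => X (Sum.inl j))
      (Fin.addCases (fun i => C ⟨exp (c i / (M.factorial : F)), (div_factorial_mem_bfld c M i).2⟩)
        fun j => X (Sum.inr j))
  let w' : Fin (N + n) ⊕ Fin (N + n) → MvPolynomial (Fin n ⊕ Fin n) (bfld K₂ c') :=
    Sum.elim (Fin.addCases (fun i => C ⟨c' i / (M.factorial : F), (div_factorial_mem_bfld c' M i).1⟩)
        fun j => X (Sum.inl j))
      (Fin.addCases (fun i => C ⟨exp (c' i / (M.factorial : F)), (div_factorial_mem_bfld c' M i).2⟩)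
        fun j => X (Sum.inr j))
  have hθw : ∀ j, MvPolynomial.map (hiso.fieldEquiv : bfld K₁ c →+* bfld K₂ c') (w j) = w' j := by
    rintro (j | j)
    · refine Fin.addCases (fun i => ?_) (fun i => ?_) j
      · simp only [w, w', Sum.elim_inl, Fin.addCases_left, map_C]
        congr 1
        exact Subtype.ext (hiso.coe_fieldEquiv_div_factorial M i).1
      · simp only [w, w', Sum.elim_inl, Fin.addCases_right, map_X]
    · refine Fin.addCases (fun i => ?_) (fun i => ?_) j
      · simp only [w, w', Sum.elim_inr, Fin.addCases_left, map_C]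
        congr 1
        exact Subtype.ext (hiso.coe_fieldEquiv_div_factorial M i).2
      · simp only [w, w', Sum.elim_inr, Fin.addCases_right, map_X]
  have hθp : MvPolynomial.map (hiso.fieldEquiv : bfld K₁ c →+* bfld K₂ c') (eval₂ (C.comp ι₀) w p₁) =
      eval₂ (C.comp ι₀') w' p := by
    have e : eval₂ (C.comp ι₀') w' p =
        eval₂ ((C.comp ι₀').comp ((subfieldEquiv σ) : (fieldOf K₁).toSubfield →+* (fieldOf K₂).toSubfield))
          w' p₁ := by
      conv_lhs => rw [hpp₁]
      rw [eval₂_map]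
    rw [e, eval₂_comp_left]
    congr 1
    · ext x
      simp only [RingHom.coe_comp, Function.comp_apply, map_C]
      rw [show (hiso.fieldEquiv : bfld K₁ c →+* bfld K₂ c') (ι₀ x) = hiso.fieldEquiv (ι₀ x) from rfl, hθι]
      rfl
    · funext j
      exact hθw j
  have hevalα' : ∀ v : Fin n ⊕ Fin n → F,
      aeval v (eval₂ (C.comp ι₀') w' p) = aeval (prodPt (gammaPt fun i => c' i / (M.factorial : F)) v) p := by
    intro v
    rw [show aeval v (eval₂ (C.comp ι₀') w' p) = (aeval v).toRingHom (eval₂ (C.comp ι₀') w' p) from rfl,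
      eval₂_comp_left, aeval_def]
    congr 1
    · ext x
      simp only [RingHom.coe_comp, Function.comp_apply, AlgHom.toRingHom_eq_coe, AlgHom.coe_toRingHom,
        aeval_C]
      rw [IntermediateField.algebraMap_apply]
      rfl
    · funext j
      rcases j with j | j
      · refine Fin.addCases (fun i => ?_) (fun i => ?_) j
        · simp only [w', Function.comp_apply, Sum.elim_inl, Fin.addCases_left, AlgHom.toRingHom_eq_coe,
            AlgHom.coe_toRingHom, aeval_C, prodPt_inl, Fin.append_left, gammaPt_inl]
          rw [IntermediateField.algebraMap_apply]
        · simp [w']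
      · refine Fin.addCases (fun i => ?_) (fun i => ?_) j
        · simp only [w', Function.comp_apply, Sum.elim_inr, Fin.addCases_left, AlgHom.toRingHom_eq_coe,
            AlgHom.coe_toRingHom, aeval_C, prodPt_inr, Fin.append_left, gammaPt_inr]
          rw [IntermediateField.algebraMap_apply]
        · simp [w']
  have hevalα : aeval (gammaPt b) (eval₂ (C.comp ι₀) w p₁) =
      aeval (gammaPt (Fin.append (fun i => c i / (M.factorial : F)) b)) p₁ := by
    rw [← prodPt_gammaPt_eq, show aeval (gammaPt b) (eval₂ (C.comp ι₀) w p₁) =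
      (aeval (gammaPt b)).toRingHom (eval₂ (C.comp ι₀) w p₁) from rfl, eval₂_comp_left, aeval_def]
    congr 1
    · ext x
      simp only [RingHom.coe_comp, Function.comp_apply, AlgHom.toRingHom_eq_coe, AlgHom.coe_toRingHom,
        aeval_C]
      rw [IntermediateField.algebraMap_apply]
      rfl
    · funext j
      rcases j with j | j
      · refine Fin.addCases (fun i => ?_) (fun i => ?_) j
        · simp only [w, Function.comp_apply, Sum.elim_inl, Fin.addCases_left, AlgHom.toRingHom_eq_coe,
            AlgHom.coe_toRingHom, aeval_C, prodPt_inl, Fin.append_left, gammaPt_inl]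
          rw [IntermediateField.algebraMap_apply]
        · simp [w]
      · refine Fin.addCases (fun i => ?_) (fun i => ?_) j
        · simp only [w, Function.comp_apply, Sum.elim_inr, Fin.addCases_left, AlgHom.toRingHom_eq_coe,
            AlgHom.coe_toRingHom, aeval_C, prodPt_inr, Fin.append_left, gammaPt_inr]
          rw [IntermediateField.algebraMap_apply]
        · simp [w]
  rw [mem_vanishingIdeal_iff]
  have key : (∀ x ∈ prodPt (gammaPt fun i => c' i / (M.factorial : F)) ''
      (zeroLocus F ((locusIdealTw hiso b).map (algebraMap (MvPolynomial (Fin n ⊕ Fin n) (bfld K₂ c'))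
        (MvPolynomial (Fin n ⊕ Fin n) F))) ∩ torusLocus F n), aeval x p = 0) ↔
      MvPolynomial.map (algebraMap (bfld K₂ c') F) (eval₂ (C.comp ι₀') w' p) ∈
        vanishingIdeal F (zeroLocus F ((locusIdealTw hiso b).map (algebraMap
          (MvPolynomial (Fin n ⊕ Fin n) (bfld K₂ c')) (MvPolynomial (Fin n ⊕ Fin n) F))) ∩ torusLocus F n) := by
    rw [mem_vanishingIdeal_iff]
    constructor
    · intro h v hv
      rw [aeval_map_algebraMap, hevalα']
      exact h _ ⟨v, hv, rfl⟩
    · rintro h _ ⟨v, hv, rfl⟩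
      rw [← hevalα', ← aeval_map_algebraMap F (x := v) (eval₂ (C.comp ι₀') w' p)]
      exact h v hv
  rw [key, vanishingIdeal_zeroLocus_inter_torusLocus _ hne, MvPolynomial.algebraMap_def, map_mem_map_iff,
    mem_locusIdealTw_iff, ← hθp, MvPolynomial.map_map,
    RingEquiv.symm_comp, MvPolynomial.map_id, hevalα]

/-! ### Strong rotundity of `W = Loc(α', V'/K₂)` from Γ-closedness of `K₁` -/

/-- **`W = Loc(α', (Z(P')_F ∩ Gⁿ)/K₂) ∩ G^{N+n}` is strongly rotund** when `K₁` is Γ-closed and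
`(c/M!, b)` is linearly independent over `K₁` (twisted form of `isStronglyRotund_locOver`): the
ideal of `{α'} × V'` over `K₂⁰` is the `σ`-transport of the ideal over `K₁⁰` of the honest source
point (`mem_vanishingIdeal_image_prodPt_iff_tw`), whose rotundity data over the Γ-closed `K₁`
(`exists_algebraicIndependent_matrixAct_of_isGammaClosed`) transport along `σ`
(`LocusComponents.algebraicIndependent_matrixAct_genericPt_mapCoeff`) and to the components.
[cite: BaysKirby2018ANT, Thm 11.6 (proof), Prop. 7.3 (proof)] -/
theorem isStronglyRotund_locOver_tw [IsAlgClosed F] (hK : IsGammaClosed K₁) {c c' : Fin N → F}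
    (hiso : IsGammaIsoTw σ c c') (b : Fin n → F) (M : ℕ)
    [hprime : ((locusIdealTw hiso b).map (algebraMap (MvPolynomial (Fin n ⊕ Fin n) (bfld K₂ c'))
      (MvPolynomial (Fin n ⊕ Fin n) F))).IsPrime]
    (hne : (zeroLocus F ((locusIdealTw hiso b).map (algebraMap (MvPolynomial (Fin n ⊕ Fin n) (bfld K₂ c'))
      (MvPolynomial (Fin n ⊕ Fin n) F))) ∩ torusLocus F n).Nonempty)
    (hlin : LinIndepOver K₁ (Fin.append (fun i => c i / (M.factorial : F)) b)) :
    IsStronglyRotund F (N + n)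
      (locOver K₂ (gammaPt fun i => c' i / (M.factorial : F))
        (zeroLocus F ((locusIdealTw hiso b).map (algebraMap (MvPolynomial (Fin n ⊕ Fin n) (bfld K₂ c'))
          (MvPolynomial (Fin n ⊕ Fin n) F))) ∩ torusLocus F n) ∩ torusLocus F (N + n)) := by
  classical
  intro M' hM'
  -- the honest source point and its ideal over `K₁⁰`, transported along `σ`
  set P₀ : Ideal (MvPolynomial (Fin (N + n) ⊕ Fin (N + n)) (fieldOf K₁).toSubfield) :=
    locIdeal (fieldOf K₁).toSubfield (gammaPt (Fin.append (fun i => c i / (M.factorial : F)) b)) with hP₀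
  have hgen₀ : IsGenericPt P₀ (gammaPt (Fin.append (fun i => c i / (M.factorial : F)) b)) :=
    isGenericPt_locIdeal _ _
  set Q₀ : Ideal (MvPolynomial (Fin (N + n) ⊕ Fin (N + n)) (fieldOf K₂).toSubfield) :=
    LocusComponents.idealMapCoeff (subfieldEquiv σ) P₀ with hQ₀def
  have hQ₀eq : MvPolynomial.vanishingIdeal (fieldOf K₂).toSubfield
      (prodPt (gammaPt fun i => c' i / (M.factorial : F)) ''
        (zeroLocus F ((locusIdealTw hiso b).map (algebraMap (MvPolynomial (Fin n ⊕ Fin n) (bfld K₂ c'))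
          (MvPolynomial (Fin n ⊕ Fin n) F))) ∩ torusLocus F n)) = Q₀ := by
    ext q
    rw [mem_vanishingIdeal_image_prodPt_iff_tw hiso b M hne q, hgen₀, hQ₀def,
      LocusComponents.idealMapCoeff, ← Ideal.comap_symm, Ideal.mem_comap, MvPolynomial.mapEquiv_symm,
      MvPolynomial.mapEquiv_apply]
  have hW : locOver K₂ (gammaPt fun i => c' i / (M.factorial : F))
      (zeroLocus F ((locusIdealTw hiso b).map (algebraMap (MvPolynomial (Fin n ⊕ Fin n) (bfld K₂ c'))
        (MvPolynomial (Fin n ⊕ Fin n) F))) ∩ torusLocus F n) = zeroLocus F Q₀ := by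
    rw [← hQ₀eq]; rfl
  haveI hQ₀ : Q₀.IsPrime := LocusComponents.idealMapCoeff_isPrime _ _
  obtain ⟨Qc, hQc⟩ := LocusComponents.exists_mem_minimalPrimes_map
    (k := (fieldOf K₂).toSubfield) (F := F) (P := Q₀)
  haveI : Qc.IsPrime := hQc.1.1
  have hY : ∀ i, (X (Sum.inr i) : MvPolynomial (Fin (N + n) ⊕ Fin (N + n)) (fieldOf K₂).toSubfield) ∉ Q₀ :=
    fun i => (LocusComponents.X_inr_notMem_mapCoeff_iff (subfieldEquiv σ) P₀ i).2
      ((LocusComponents.X_inr_notMem_iff P₀ hgen₀ i).2 (by rw [gammaPt_inr]; exact exp_ne_zero _))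
  have hnec := LocusComponents.component_inter_torusLocus_nonempty hQc hY
  -- `rk M' + 1` algebraically independent coordinates over `K₁⁰`, transported along `σ` and to the component
  obtain ⟨s, hs⟩ := exists_algebraicIndependent_matrixAct_of_isGammaClosed hK hlin M' hM'
  have hs' : AlgebraicIndependent (fieldOf K₁).toSubfield
      fun i => matrixAct M' (gammaPt (Fin.append (fun i => c i / (M.factorial : F)) b)) (s i) := hs
  have h0 := LocusComponents.algebraicIndependent_matrixAct_genericPt P₀ hgen₀ M' s hs'
  have h1 : AlgebraicIndependent (fieldOf K₂).toSubfield fun i => matrixAct M' (genericPt Q₀) (s i) :=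
    LocusComponents.algebraicIndependent_matrixAct_genericPt_mapCoeff (subfieldEquiv σ) P₀ M' s h0
  have h2 := LocusComponents.algebraicIndependent_funcMap hQc h1
  have h3 : (LocusComponents.funcMap hQc) ∘ (fun i => matrixAct M' (genericPt Q₀) (s i)) =
      fun i => matrixAct M' (genericPt Qc) (s i) := by
    funext i
    simp only [Function.comp_apply]
    rw [← LocusComponents.funcMap_comp_genericPt hQc, ← LocusComponents.map_matrixAct]
    rfl
  rw [h3] at h2
  have h4 := le_zariskiDim_image_matrixAct' Qc (isGenericPt_genericPt Qc) hnec M' (fun i => X (s i))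
    (by simpa only [aeval_X] using h2)
  have h5 : matrixAct M' '' (zeroLocus F Qc ∩ torusLocus F (N + n)) ⊆
      matrixAct M' '' (locOver K₂ (gammaPt fun i => c' i / (M.factorial : F))
        (zeroLocus F ((locusIdealTw hiso b).map (algebraMap (MvPolynomial (Fin n ⊕ Fin n) (bfld K₂ c'))
          (MvPolynomial (Fin n ⊕ Fin n) F))) ∩ torusLocus F n) ∩ torusLocus F (N + n)) := by
    rw [hW]
    exact Set.image_mono (inter_subset_inter_left _ (LocusComponents.zeroLocus_subset_zeroLocus hQc))
  calc ((M'.map (Int.cast : ℤ → ℚ)).rank : WithBot ℕ∞)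
      < (((M'.map (Int.cast : ℤ → ℚ)).rank + 1 : ℕ) : WithBot ℕ∞) := by
        exact_mod_cast Nat.lt_succ_self _
    _ ≤ zariskiDim F (matrixAct M' '' (zeroLocus F Qc ∩ torusLocus F (N + n))) := h4
    _ ≤ _ := zariskiDim_mono h5

/-! ### `Z(P')_F` is defined over `K₂(c'/M!, exp (c'/M!))` for large `M` -/

/-- **`Z(P')_F` is defined over `K₂(c'/M!, exp(c'/M!))` for all large `M`** (twisted form of
`exists_forall_isDefinedOver_adjoinPt`). [cite: BaysKirby2018ANT, Def. 11.1 ("`V` is defined over `K(α)`")] -/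
theorem exists_forall_isDefinedOver_adjoinPt_tw {c c' : Fin N → F} (hiso : IsGammaIsoTw σ c c') (b : Fin n → F) :
    ∃ M₀ : ℕ, ∀ M, M₀ ≤ M → IsDefinedOver (adjoinPt K₂ fun i => c' i / (M.factorial : F))
      (zeroLocus F ((locusIdealTw hiso b).map (algebraMap (MvPolynomial (Fin n ⊕ Fin n) (bfld K₂ c'))
        (MvPolynomial (Fin n ⊕ Fin n) F)))) := by
  classical
  obtain ⟨gs, hgs⟩ := (inferInstance : IsNoetherianRing (MvPolynomial (Fin n ⊕ Fin n) (bfld K₂ c'))).noetherian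
    (locusIdealTw hiso b)
  have hcoef : ∀ z : bfld K₂ c', ∃ M₀ : ℕ, ∀ M, M₀ ≤ M → (z : F) ∈ adjoinPt K₂ fun i => c' i / (M.factorial : F) :=
    fun z => exists_forall_mem_adjoinPt_of_mem_bfld z.2
  choose Mz hMz using hcoef
  refine ⟨gs.sup fun p => p.coeffs.sup Mz, fun M hM => ?_⟩
  have hmem : ∀ p ∈ gs, ∀ z ∈ p.coeffs, (z : F) ∈ adjoinPt K₂ fun i => c' i / (M.factorial : F) :=
    fun p hp z hz => hMz z M (((Finset.le_sup hz).trans (Finset.le_sup (f := fun p => p.coeffs.sup Mz) hp)).trans hM)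
  let j : (adjoinPt K₂ fun i => c' i / (M.factorial : F)) →+* bfld K₂ c' :=
    { toFun := fun x => ⟨x, by
        have hle : (adjoinPt K₂ fun i => c' i / (M.factorial : F)) ≤ (bfld K₂ c').toSubfield := by
          refine Subfield.closure_le.2 (union_subset ?_ ?_)
          · intro y hy; exact (bfld K₂ c').algebraMap_mem ⟨y, hy⟩
          · rintro _ ⟨r, rfl⟩
            rcases r with i | i
            · exact (div_factorial_mem_bfld c' M i).1
            · exact (div_factorial_mem_bfld c' M i).2
        exact hle x.2⟩
      map_one' := Subtype.ext rfl
      map_mul' := fun _ _ => Subtype.ext rfl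
      map_zero' := Subtype.ext rfl
      map_add' := fun _ _ => Subtype.ext rfl }
  have hlift : ∀ p ∈ gs, ∃ q : MvPolynomial (Fin n ⊕ Fin n) (adjoinPt K₂ fun i => c' i / (M.factorial : F)),
      MvPolynomial.map j q = p := by
    intro p hp
    change p ∈ Set.range (MvPolynomial.map j)
    rw [MvPolynomial.mem_range_map_iff_coeffs_subset]
    intro z hz
    exact ⟨⟨z, hmem p hp z (Finset.mem_coe.1 hz)⟩, Subtype.ext rfl⟩
  choose q hq using hlift
  refine ⟨Ideal.span (Set.range fun p : gs => q p.1 p.2), ?_⟩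
  rw [MvPolynomial.algebraMap_def, Literature.RingTheory.KrullDimension.zeroLocus_map, ← hgs]
  ext x
  rw [zeroLocus_span, zeroLocus_span]
  simp only [Set.mem_setOf_eq, Set.forall_mem_range, Subtype.forall, Finset.mem_coe]
  refine forall₂_congr fun p hp => ?_
  conv_lhs => rw [← hq p hp, aeval_def, eval₂_map]
  rw [aeval_def]
  rfl

/-! ### The generic partner from GSΓC over `K₂`, and the isomorphism step -/

set_option synthInstance.maxHeartbeats 200000 in
set_option maxHeartbeats 400000 in
/-- **The generic partner from GSΓC, over `σ`** (twisted form of `exists_generic_partner_of_gsgc`;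
Bays–Kirby 2018, proof of Prop. 11.2 / Thm 11.6 along the lines of Lemma 8.3). Let `K₁` be
Γ-closed in the algebraically closed `F`, `F` generically strongly Γ-closed over `K₂`, `c ↦ c'` a
Γ-isomorphism over `σ` between tuples linearly independent over `K₁`, `K₂` with `K₁ + ℚc ◁ F`,
`K₂ + ℚc' ◁ F`; `b` an `n`-tuple linearly independent over `K₁ + ℚc` with `td(b/K₁ + ℚc) = n`,
free, with `⟨K₁ c⟩` relatively algebraically closed in `⟨K₁ c⟩(b, exp b)`. Then there is `g` with
`(g, exp g)` a generic point of `θ(I((b, exp b)/⟨K₁ c⟩))` over `⟨K₂ c'⟩`, `g` linearly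
independent over `K₂ + ℚc'`, and `td(g/K₂ + ℚc') = n`.
[cite: BaysKirby2018ANT, Prop. 11.2, Thm 11.6 (proof), Lemma 8.3 (proof)] -/
theorem exists_generic_partner_of_gsgc_tw [IsAlgClosed F] (hK : IsGammaClosed K₁)
    (hG : IsGenericallyStronglyGammaClosedOver K₂) {c c' : Fin N → F} (hiso : IsGammaIsoTw σ c c')
    (hc : LinIndepOver K₁ c) (hc' : LinIndepOver K₂ c')
    (hX : IsStrong (K₁ ⊔ Submodule.span ℚ (range c)))
    (hX' : IsStrong (K₂ ⊔ Submodule.span ℚ (range c'))) {b : Fin n → F}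
    (hb : LinIndepOver (K₁ ⊔ Submodule.span ℚ (range c)) b)
    (htd : td (K₁ ⊔ Submodule.span ℚ (range c)) (Submodule.span ℚ (range b)) = n)
    (hfree : ∀ m : Fin n → ℤ, m ≠ 0 →
      ∑ j, (m j : ℚ) • b j ∉ acl (gens (K₁ ⊔ Submodule.span ℚ (range c))) ∧
      exp (∑ j, (m j : ℚ) • b j) ∉ acl (gens (K₁ ⊔ Submodule.span ℚ (range c))))
    (hrac : ∀ z ∈ IntermediateField.adjoin (fieldOf K₁) (allGens c ∪ range (gammaPt b)),
      IsAlgebraic (bfld K₁ c) z → z ∈ bfld K₁ c) :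
    ∃ g : Fin n → F, IsGenericPt (locusIdealTw hiso b) (gammaPt g) ∧
      LinIndepOver (K₂ ⊔ Submodule.span ℚ (range c')) g ∧
      td (K₂ ⊔ Submodule.span ℚ (range c')) (Submodule.span ℚ (range g)) = n := by
  classical
  haveI hP' : (locusIdealTw hiso b).IsPrime := locusIdealTw_isPrime hiso b
  haveI hQ : ((locusIdealTw hiso b).map (algebraMap (MvPolynomial (Fin n ⊕ Fin n) (bfld K₂ c'))
      (MvPolynomial (Fin n ⊕ Fin n) F))).IsPrime := by
    rw [MvPolynomial.algebraMap_def]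
    exact isPrime_map_locusIdealTw hiso b hrac
  have hQmin : (locusIdealTw hiso b).map (algebraMap (MvPolynomial (Fin n ⊕ Fin n) (bfld K₂ c'))
      (MvPolynomial (Fin n ⊕ Fin n) F)) ∈ ((locusIdealTw hiso b).map (algebraMap
        (MvPolynomial (Fin n ⊕ Fin n) (bfld K₂ c')) (MvPolynomial (Fin n ⊕ Fin n) F))).minimalPrimes := by
    rw [Ideal.minimalPrimes_eq_subsingleton_self]
    exact mem_singleton _
  have hY : ∀ i, (MvPolynomial.X (Sum.inr i) : MvPolynomial (Fin n ⊕ Fin n) (bfld K₂ c')) ∉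
      locusIdealTw hiso b := fun i =>
    (LocusComponents.X_inr_notMem_mapCoeff_iff hiso.fieldEquiv (locusIdeal K₁ c b) i).2
      (X_inr_notMem_locusIdeal K₁ c b i)
  have hrot : ∀ M : Matrix (Fin n) (Fin n) ℤ,
      ∃ s : Fin (M.map (Int.cast : ℤ → ℚ)).rank → Fin n ⊕ Fin n,
        AlgebraicIndependent (bfld K₂ c') fun i => matrixAct M (genericPt (locusIdealTw hiso b)) (s i) := by
    intro M
    obtain ⟨s, hs⟩ := exists_algebraicIndependent_matrixAct K₁ c b hX hb M
    refine ⟨s, LocusComponents.algebraicIndependent_matrixAct_genericPt_mapCoeff hiso.fieldEquiv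
      (locusIdeal K₁ c b) M s ?_⟩
    exact LocusComponents.algebraicIndependent_matrixAct_genericPt (locusIdeal K₁ c b)
      (isGenericPt_locusIdeal K₁ c b) M s hs
  have hadd : ∀ m : Fin n → ℤ, m ≠ 0 → Transcendental (bfld K₂ c')
      (∑ i, (m i : zeroLocusFunctionField (locusIdealTw hiso b)) *
        genericPt (locusIdealTw hiso b) (Sum.inl i)) := by
    intro m hm
    refine LocusComponents.transcendental_sum_genericPt_mapCoeff hiso.fieldEquiv (locusIdeal K₁ c b) m ?_
    exact LocusComponents.transcendental_sum_genericPt (locusIdeal K₁ c b) (isGenericPt_locusIdeal K₁ c b) m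
      (transcendental_sum K₁ c b m (hfree m hm).1)
  have hmul : ∀ m : Fin n → ℤ, m ≠ 0 → Transcendental (bfld K₂ c')
      (∏ i, genericPt (locusIdealTw hiso b) (Sum.inr i) ^ m i) := by
    intro m hm
    refine LocusComponents.transcendental_prod_genericPt_mapCoeff hiso.fieldEquiv (locusIdeal K₁ c b) m ?_
    exact LocusComponents.transcendental_prod_genericPt (locusIdeal K₁ c b) (isGenericPt_locusIdeal K₁ c b) m
      (transcendental_prod K₁ c b m (hfree m hm).2)
  have hirr : IsIrreducibleClosed F (zeroLocus F ((locusIdealTw hiso b).map (algebraMap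
      (MvPolynomial (Fin n ⊕ Fin n) (bfld K₂ c')) (MvPolynomial (Fin n ⊕ Fin n) F)))) :=
    LocusComponents.isIrreducibleClosed_component
  have hne := LocusComponents.component_inter_torusLocus_nonempty hQmin hY
  have hrotW := LocusComponents.isRotund_component hQmin hY hrot
  have haddW := LocusComponents.isAddFree_component hQmin hY hadd
  have hmulW := LocusComponents.isMulFree_component hQmin hY hmul
  have hdimP : ringKrullDim (zeroLocusCoordRing (locusIdeal K₁ c b)) = n :=
    ringKrullDim_coordRing_locusIdeal_eq K₁ c b htd
  have hdimP' : ringKrullDim (zeroLocusCoordRing (locusIdealTw hiso b)) = n := by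
    rw [locusIdealTw, LocusComponents.ringKrullDim_quotient_mapCoeff]; exact hdimP
  have hdimW : zariskiDim F (zeroLocus F ((locusIdealTw hiso b).map (algebraMap
      (MvPolynomial (Fin n ⊕ Fin n) (bfld K₂ c')) (MvPolynomial (Fin n ⊕ Fin n) F)))) = n := by
    rw [LocusComponents.zariskiDim_component hQmin]; exact hdimP'
  obtain ⟨M₀, hM₀⟩ := exists_forall_isDefinedOver_adjoinPt_tw hiso b
  have hdef := hM₀ M₀ le_rfl
  have hlinA : LinIndepOver K₂ fun i => c' i / (M₀.factorial : F) := linIndepOver_div_factorial hc' M₀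
  have hstrA : IsStrong (K₂ ⊔ Submodule.span ℚ (range fun i => c' i / (M₀.factorial : F))) := by
    rw [span_range_div_factorial]; exact hX'
  have hlin : LinIndepOver K₁ (Fin.append (fun i => c i / (M₀.factorial : F)) b) := by
    refine (linIndepOver_div_factorial hc M₀).append ?_
    rw [span_range_div_factorial]; exact hb
  have hsrot := isStronglyRotund_locOver_tw hK hiso b M₀ hne hlin
  obtain ⟨g, hgW, hglin⟩ := hG n N _ _ hirr hne hdimW haddW hmulW hrotW hlinA hstrA hdef hsrot
  rw [span_range_div_factorial] at hglin
  have hfg : IsFG (K₂ ⊔ Submodule.span ℚ (range c')) (Submodule.span ℚ (range g)) :=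
    isFG_span_of_finite _ (finite_range g)
  have hδ : 0 ≤ predim (K₂ ⊔ Submodule.span ℚ (range c')) (Submodule.span ℚ (range g)) :=
    (isStrong_iff.1 hX') _ hfg
  have hldim : ldim (K₂ ⊔ Submodule.span ℚ (range c')) (Submodule.span ℚ (range g)) = n :=
    ldim_span_eq_of_linIndepOver hglin
  have htd_ge : (n : ℕ∞) ≤ td (K₂ ⊔ Submodule.span ℚ (range c')) (Submodule.span ℚ (range g)) := by
    rw [predim_def, hldim] at hδ
    have h1 : n ≤ (td (K₂ ⊔ Submodule.span ℚ (range c')) (Submodule.span ℚ (range g))).toNat := by omega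
    rw [← ENat.coe_toNat (td_ne_top hfg)]
    exact_mod_cast h1
  have hrel : (algMatroid F).relRank (((bfld K₂ c').restrictScalars ℚ : IntermediateField ℚ F) : Set F)
      (range (gammaPt g)) = td (K₂ ⊔ Submodule.span ℚ (range c')) (Submodule.span ℚ (range g)) :=
    relRank_range_gammaPt K₂ c' g
  have hzP' : gammaPt g ∈ zeroLocus F (locusIdealTw hiso b) :=
    LocusComponents.zeroLocus_subset_zeroLocus hQmin hgW
  have htrP' : Algebra.trdeg (bfld K₂ c') (zeroLocusCoordRing (locusIdealTw hiso b)) = n := by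
    have h1 := Literature.RingTheory.KrullDimension.ringKrullDim_eq_trdeg (bfld K₂ c')
      (zeroLocusCoordRing (locusIdealTw hiso b))
    rw [hdimP'] at h1
    have h2 : Cardinal.toNat (Algebra.trdeg (bfld K₂ c') (zeroLocusCoordRing (locusIdealTw hiso b))) = n := by
      exact_mod_cast h1.symm
    rw [Literature.RingTheory.KrullDimension.trdeg_eq_toNat (bfld K₂ c')
      (zeroLocusCoordRing (locusIdealTw hiso b)), h2]
  have hgen : IsGenericPt (locusIdealTw hiso b) (gammaPt g) := by
    refine LocusComponents.isGenericPt_of_trdeg_le _ hzP' ?_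
    rw [htrP']
    refine Cardinal.natCast_le_toENat.1 ?_
    rw [toENat_trdeg_adjoin_bfld, hrel]
    exact htd_ge
  have htd_eq : td (K₂ ⊔ Submodule.span ℚ (range c')) (Submodule.span ℚ (range g)) = n := by
    refine le_antisymm ?_ htd_ge
    rw [← hrel, ← toENat_trdeg_adjoin_bfld, ← trdeg_coordRing_eq_of_isGenericPt hgen, htrP',
      Cardinal.toENat_nat]
  exact ⟨g, hgen, hglin, htd_eq⟩

/-- **The isomorphism step over `σ`** (twisted form of `exists_isGammaIso_append_of_gsgc`;
Bays–Kirby 2018, end of the proof of Lemma 8.3, here for Prop. 11.2 over a base isomorphism):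
in the situation of `exists_generic_partner_of_gsgc_tw`, if moreover `exp b₁, …, exp bₙ` are
Kummer-independent in `⟨K₁ c⟩(b, exp b)` (a normalised good basis), then there is `g` with
`(c, b) ↦ (c', g)` a Γ-isomorphism over `σ` and `K₂ + ℚc' + ℚg ◁ F`.
[cite: BaysKirby2018ANT, Prop. 11.2, Lemma 8.3 (proof), Prop. 3.22, Lemma 4.8] -/
theorem exists_isGammaIsoTw_append_of_gsgc [IsAlgClosed F] (hK : IsGammaClosed K₁)
    (hG : IsGenericallyStronglyGammaClosedOver K₂) {c c' : Fin N → F} (hiso : IsGammaIsoTw σ c c')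
    (hc : LinIndepOver K₁ c) (hc' : LinIndepOver K₂ c')
    (hX : IsStrong (K₁ ⊔ Submodule.span ℚ (range c)))
    (hX' : IsStrong (K₂ ⊔ Submodule.span ℚ (range c'))) {b : Fin n → F}
    (hb : LinIndepOver (K₁ ⊔ Submodule.span ℚ (range c)) b)
    (htd : td (K₁ ⊔ Submodule.span ℚ (range c)) (Submodule.span ℚ (range b)) = n)
    (hfree : ∀ m : Fin n → ℤ, m ≠ 0 →
      ∑ j, (m j : ℚ) • b j ∉ acl (gens (K₁ ⊔ Submodule.span ℚ (range c))) ∧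
      exp (∑ j, (m j : ℚ) • b j) ∉ acl (gens (K₁ ⊔ Submodule.span ℚ (range c))))
    (hrac : ∀ z ∈ IntermediateField.adjoin (fieldOf K₁) (allGens c ∪ range (gammaPt b)),
      IsAlgebraic (bfld K₁ c) z → z ∈ bfld K₁ c)
    (hkum : ∀ m, 0 < m → IndepModPowers m (fun j =>
      (⟨exp (b j), IntermediateField.subset_adjoin _ _ (Or.inr ⟨Sum.inr j, rfl⟩)⟩ :
        IntermediateField.adjoin (fieldOf K₁) (allGens c ∪ range (gammaPt b))))) :
    ∃ g : Fin n → F, IsGammaIsoTw σ (Fin.append c b) (Fin.append c' g) ∧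
      IsStrong (K₂ ⊔ Submodule.span ℚ (range (Fin.append c' g))) := by
  classical
  obtain ⟨g, hgen, hglin, htd'⟩ :=
    exists_generic_partner_of_gsgc_tw hK hG hiso hc hc' hX hX' hb htd hfree hrac
  let σF : bfld K₁ c →+* F := (algebraMap (bfld K₂ c') F).comp (hiso.fieldEquiv : bfld K₁ c →+* bfld K₂ c')
  have hiff : ∀ p : MvPolynomial (Fin n ⊕ Fin n) (bfld K₁ c),
      aeval (gammaPt b) p = 0 ↔ eval₂ σF (gammaPt g) p = 0 := by
    intro p
    have h1 : aeval (gammaPt b) p = 0 ↔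
        MvPolynomial.map (hiso.fieldEquiv : bfld K₁ c →+* bfld K₂ c') p ∈ locusIdealTw hiso b := by
      rw [mem_locusIdealTw_iff, MvPolynomial.map_map, RingEquiv.symm_comp, MvPolynomial.map_id]
    rw [h1, ← hgen, aeval_def, eval₂_map]
  let τ₂ := pointFieldHom σF (gammaPt b) (gammaPt g) hiff
  have hmemΩ₂ : ∀ z : F, z ∈ IntermediateField.adjoin (fieldOf K₁) (allGens c ∪ range (gammaPt b)) →
      z ∈ IntermediateField.adjoin (bfld K₁ c) (range (gammaPt b)) := by
    intro z hz
    rw [← IntermediateField.mem_restrictScalars (fieldOf K₁), IntermediateField.adjoin_adjoin_left]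
    exact hz
  let jf : IntermediateField.adjoin (fieldOf K₁) (allGens c ∪ range (gammaPt b)) →+*
      IntermediateField.adjoin (bfld K₁ c) (range (gammaPt b)) :=
    { toFun := fun x => ⟨x, hmemΩ₂ x x.2⟩
      map_one' := Subtype.ext rfl
      map_mul' := fun _ _ => Subtype.ext rfl
      map_zero' := Subtype.ext rfl
      map_add' := fun _ _ => Subtype.ext rfl }
  let τ : IntermediateField.adjoin (fieldOf K₁) (allGens c ∪ range (gammaPt b)) →+* F := τ₂.comp jf
  have hτE : ∀ (z : F) (hz : z ∈ IntermediateField.adjoin (fieldOf K₁) (allGens c)),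
      τ ⟨z, adjoinField_le_adjoin_union c b hz⟩ = (hiso.fieldEquiv ⟨z, hz⟩ : F) := by
    intro z hz
    have hj : jf ⟨z, adjoinField_le_adjoin_union c b hz⟩ =
        algebraMap (bfld K₁ c) (IntermediateField.adjoin (bfld K₁ c) (range (gammaPt b))) ⟨z, hz⟩ :=
      Subtype.ext (by rw [IntermediateField.coe_algebraMap_apply, IntermediateField.algebraMap_apply]; rfl)
    show τ₂ (jf ⟨z, _⟩) = _
    rw [hj, pointFieldHom_algebraMap]
    simp only [σF, RingHom.coe_comp, Function.comp_apply]
    rw [IntermediateField.algebraMap_apply]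
    rfl
  have hτb : ∀ j, τ ⟨b j, IntermediateField.subset_adjoin _ _ (Or.inr ⟨Sum.inl j, rfl⟩)⟩ = g j := by
    intro j
    have hj : jf ⟨b j, IntermediateField.subset_adjoin _ _ (Or.inr ⟨Sum.inl j, rfl⟩)⟩ =
        ⟨gammaPt b (Sum.inl j), IntermediateField.subset_adjoin _ _ (mem_range_self _)⟩ := Subtype.ext rfl
    show τ₂ (jf ⟨b j, _⟩) = _
    rw [hj, pointFieldHom_apply_self, gammaPt_inl]
  have hτe : ∀ j, τ ⟨exp (b j), IntermediateField.subset_adjoin _ _ (Or.inr ⟨Sum.inr j, rfl⟩)⟩ = exp (g j) := by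
    intro j
    have hj : jf ⟨exp (b j), IntermediateField.subset_adjoin _ _ (Or.inr ⟨Sum.inr j, rfl⟩)⟩ =
        ⟨gammaPt b (Sum.inr j), IntermediateField.subset_adjoin _ _ (mem_range_self _)⟩ := Subtype.ext rfl
    show τ₂ (jf ⟨exp (b j), _⟩) = _
    rw [hj, pointFieldHom_apply_self, gammaPt_inr]
  have hγ : IsGammaIsoTw σ (Fin.append c b) (Fin.append c' g) :=
    hiso.append_of_ringHom_adjoin hK τ hτE hτb hτe hkum
  have hfg : IsFG (K₂ ⊔ Submodule.span ℚ (range c')) (Submodule.span ℚ (range g)) :=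
    isFG_span_of_finite _ (finite_range g)
  have hldim : ldim (K₂ ⊔ Submodule.span ℚ (range c')) (Submodule.span ℚ (range g)) = n :=
    ldim_span_eq_of_linIndepOver hglin
  have hδ0 : predim (K₂ ⊔ Submodule.span ℚ (range c'))
      ((K₂ ⊔ Submodule.span ℚ (range c')) ⊔ Submodule.span ℚ (range g)) = 0 := by
    rw [predim_sup_left, predim_def, hldim, htd']
    simp
  have hstrong : IsStrong ((K₂ ⊔ Submodule.span ℚ (range c')) ⊔ Submodule.span ℚ (range g)) :=
    hX'.of_predim_eq_zero le_sup_left (isFG_sup_left.2 hfg) hδ0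
  refine ⟨g, hγ, ?_⟩
  rw [ZilberHomogeneity.range_append, Submodule.span_union, ← sup_assoc]
  exact hstrong

end GammaField

end Literature.NumberTheory.Transcendental
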